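import Summits.ValiantsHypothesis.ValiantsHypothesis.Theorems.DefinabilityGapLowDegreeRung
import Summits.ValiantsHypothesis.ValiantsHypothesis.Theorems.DefinabilityGapSymmetry
import HarnessLib

/-!
# DefinabilityGap — quadratic rung of the planted KI permanent generator, part 1: unique reading of the witness exponent

Part 1 of 2 (split for the 400-line rule; part 2 = `DefinabilityGapQuadraticRung`, main theorem `kiPer_hits_quadratic`).
Source: decomp-valiant lens-5 g15 kernel file `DefinabilityGapQuadraticRung.lean` (sha256 2ea517c7…, HOME decomp-val-lens-5/v15/), landed verbatim
by the census prover seat in two files; supports stmt-ValiantsHypothesis-23444 (`KIAnnihilatorCHDefinable`) / 23547 (`KIPlantedHitting`). Original header: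

# DefinabilityGap — the QUADRATIC RUNG of the planted Kabanets–Impagliazzo permanent generator (unconditional)

Route `route-ValiantsHypothesis-DefinabilityGap` (decomp-valiant cycle 1, lens 5: hardness–randomness / PIT axis),
supporting the bet item `KIAnnihilatorCHDefinable` (stmt-ValiantsHypothesis-23444: the degree profile of the ideal of
`G_m`) and the hitting residual `KIPlantedHitting` (stmt-ValiantsHypothesis-23547).

MAIN THEOREM `kiPer_hits_quadratic`: for every `m ≥ 3`, NO nonzero polynomial of total degree `≤ 2` in the `q(m)³`
coordinate variables annihilates `G_m = (per_m(y|S_c))_{c ∈ 𝔽_q³}`. The tree's low-degree rung `kiPer_hits_lowDegree`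
needs `2k < m`, so at `k = 2` it is silent for `m = 3, 4`; this file closes that gap (the numeric instrument T-K2ch-deg2
of the route folder, `v4/instrument-sym-m3.md`, observed it at `m = 3`). Sharp: false at `m = 2` (80 linear annihilators).

Proof (unique reading, in the original coordinates). For a pair of coordinates `(c, c')` use the witness exponent
`W = μ(c, id) + μ(c', rot)`: the diagonal pattern of block `c` plus the pattern of the cyclic shift `rot = finRotate m`
in block `c'`. The matrix positions of `id` and `rot` are disjoint and form ONE `2m`-cycle, so a permutation using only
positions of `id ∪ rot` is `id` or `rot` (`perm_eq_one_or_finRotate`, via `isCycle_finRotate_of_le`). Hence if a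
product of a monomial of `G_m(d)` and a monomial of `G_m(d')` has exponent `W`, the two patterns are `{id, rot}` and
each block shares `m ≥ 3` cells with `S_c` resp. `S_{c'}`, forcing `{d, d'} = {c, c'}` (two quadratic curves share `≤ 2`
cells, `quadDesign_isNWDesign`). So the coefficient of `y^W` in `D ∘ G_m` is `D`'s coefficient at `z_c z_{c'}` times
`1` (or `2` if `c = c'`); lower-degree monomials of `D` do not reach `y`-degree `2m` (`G_m(d)` is homogeneous of degree
`m`). If `D` has no degree-2 monomial the affine rung applies. 0 sorry.

This part: §1 transported permutation patterns `μ(c, ρ)`; §2 the `2m`-cycle `id ∪ rot` has exactly two perfect matchings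
(`perm_eq_one_or_finRotate`); §3 unique reading of `W(c,c') = μ(c, id) + μ(c', rot)` (`reading_unique`). 0 sorry; VP ≠ VNP untouched.
-/

set_option linter.dupNamespace false

noncomputable section

open MvPolynomial
open Literature.Computability.AlgebraicComplexity Literature.Computability.MetaComplexity

namespace Summit.ValiantsHypothesis.ValiantsHypothesis.Theorems.DefinabilityGapAffineRung

section QuadraticRung

variable {m : ℕ}

/-! ## 1. Transported permutation patterns `μ(c, ρ)` -/

/-- The exponent of the `ρ`-term of `G_m(c)`: the permutation pattern `μ_ρ` pushed into block `S_c`. [this file] -/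
def pmono (m : ℕ) (c : Fin 3 → Fin (qOf m)) (ρ : Equiv.Perm (Fin m)) : (Fin (qOf m) × Fin (qOf m)) →₀ ℕ :=
  Finsupp.mapDomain (cellEmb m c) (permMonomial ρ)

/-- `μ(c, ρ)` has coefficient `1` in `G_m(c)`. [this file] -/
theorem coeff_pmono_kiPer_self (c : Fin 3 → Fin (qOf m)) (ρ : Equiv.Perm (Fin m)) :
    coeff (pmono m c ρ) (kiPer m c) = 1 := by
  rw [kiPer_eq_rename_cellEmb, pmono, coeff_rename_mapDomain _ (cellEmb m c).injective,
    coeff_permMonomial_perPoly]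

/-- Every monomial of `G_m(c)` is some `μ(c, ρ)`. [this file] -/
theorem exists_pmono_of_coeff_kiPer_ne_zero {c : Fin 3 → Fin (qOf m)} {u : (Fin (qOf m) × Fin (qOf m)) →₀ ℕ}
    (h : coeff u (kiPer m c) ≠ 0) : ∃ ρ : Equiv.Perm (Fin m), u = pmono m c ρ := by
  rw [kiPer_eq_rename_cellEmb] at h
  obtain ⟨v, hv, hcoeff⟩ := coeff_rename_ne_zero _ _ _ h
  obtain ⟨ρ, rfl⟩ := exists_permMonomial_eq_of_coeff_perPoly_ne_zero ℂ hcoeff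
  exact ⟨ρ, hv.symm⟩

/-- The cells of `μ(c, ρ)`. [this file] -/
theorem mem_support_pmono {c : Fin 3 → Fin (qOf m)} {ρ : Equiv.Perm (Fin m)}
    {s : Fin (qOf m) × Fin (qOf m)} : s ∈ (pmono m c ρ).support ↔ ∃ a, s = cellEmb m c (ρ a, a) := by
  classical
  rw [pmono, Finsupp.mapDomain_support_of_injective (cellEmb m c).injective, support_permMonomial,
    Finset.mem_image]
  constructor
  · rintro ⟨x, hx, rfl⟩
    obtain ⟨a, -, rfl⟩ := Finset.mem_map.1 hx
    exact ⟨a, rfl⟩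
  · rintro ⟨a, rfl⟩
    exact ⟨(ρ a, a), Finset.mem_map.2 ⟨a, Finset.mem_univ _, rfl⟩, rfl⟩

/-- `μ(c, ρ)` has `m` cells. [this file] -/
theorem card_support_pmono (c : Fin 3 → Fin (qOf m)) (ρ : Equiv.Perm (Fin m)) :
    (pmono m c ρ).support.card = m := by
  classical
  rw [pmono, Finsupp.mapDomain_support_of_injective (cellEmb m c).injective,
    Finset.card_image_of_injective _ (cellEmb m c).injective, card_support_permMonomial, Fintype.card_fin]

/-- The abscissa of the seed cell of matrix position `x` in block `c` does not depend on `c`. [this file] -/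
theorem cellEmb_fst (c : Fin 3 → Fin (qOf m)) (x : Fin m × Fin m) :
    (cellEmb m c x).1 = permPad (sq_le_qOf m) x := by
  rw [cellEmb, Function.Embedding.trans_apply, DefinabilityGapSymmetry.quadDesign_fst]

/-- Equal seed cells have equal matrix positions (whatever the blocks). [this file] -/
theorem pos_eq_of_cellEmb_eq {c d : Fin 3 → Fin (qOf m)} {x y : Fin m × Fin m}
    (h : cellEmb m c x = cellEmb m d y) : x = y :=
  (permPad (sq_le_qOf m)).injective (by rw [← cellEmb_fst c x, ← cellEmb_fst d y, h])

/-- If the cells of `μ(d, ρ)` lie among the cells of `μ(c, σ)` then `d = c` (`m ≥ 3` cells of one block inside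
another; two curves share `≤ 2`). [this file] -/
theorem eq_of_support_pmono_subset (hm : 3 ≤ m) {c d : Fin 3 → Fin (qOf m)} {ρ σ : Equiv.Perm (Fin m)}
    (h : (pmono m d ρ).support ⊆ (pmono m c σ).support) : d = c := by
  by_contra hdc
  have h1 : (pmono m d ρ).support ⊆ Finset.univ.map (quadDesign m d) :=
    support_mapDomain_cellEmb_subset m d _
  have h2 : (pmono m d ρ).support ⊆ Finset.univ.map (quadDesign m c) :=
    h.trans (support_mapDomain_cellEmb_subset m c _)
  have hle := (Finset.card_le_card (Finset.subset_inter h1 h2)).trans (quadDesign_isNWDesign m hdc)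
  rw [card_support_pmono] at hle
  omega

/-- `G_m(c)` is homogeneous of degree `m`. [this file] -/
theorem kiPer_isHomogeneous (c : Fin 3 → Fin (qOf m)) : (kiPer m c).IsHomogeneous m := by
  have h := (perPoly_isHomogeneous (n := Fin m) (k := ℂ)).rename_isHomogeneous (f := cellEmb m c)
  rw [Fintype.card_fin] at h
  rw [kiPer_eq_rename_cellEmb]
  exact h

/-- `μ(c, ρ)` has degree `m`. [this file] -/
theorem degree_pmono (c : Fin 3 → Fin (qOf m)) (ρ : Equiv.Perm (Fin m)) : (pmono m c ρ).degree = m := by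
  by_contra h
  have h1 := (kiPer_isHomogeneous c).coeff_eq_zero h
  rw [coeff_pmono_kiPer_self] at h1
  exact one_ne_zero h1

/-! ## 2. The `2m`-cycle `id ∪ rot` has exactly two perfect matchings -/

/-- `rot = finRotate m` moves every point (`m ≥ 2`). [folklore] -/
theorem finRotate_apply_ne (hm : 2 ≤ m) (a : Fin m) : finRotate m a ≠ a := by
  have h : a ∈ (finRotate m).support := by
    rw [support_finRotate_of_le hm]
    exact Finset.mem_univ a
  exact Equiv.Perm.mem_support.1 h

/-- **A permutation inside the positions of `id ∪ rot` is `id` or `rot`** (the union is one `2m`-cycle). [folklore] -/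
theorem perm_eq_one_or_finRotate (hm : 2 ≤ m) (ρ : Equiv.Perm (Fin m))
    (h : ∀ a, ρ a = a ∨ ρ a = finRotate m a) : ρ = 1 ∨ ρ = finRotate m := by
  by_cases h1 : ∀ a, ρ a = a
  · exact Or.inl (Equiv.ext fun a => by rw [Equiv.Perm.one_apply]; exact h1 a)
  · push Not at h1
    obtain ⟨a₀, ha₀⟩ := h1
    have h0 : ρ a₀ = finRotate m a₀ := (h a₀).resolve_left ha₀
    -- the set of points where `ρ` agrees with `rot` is `rot`-closed
    have hstep : ∀ b, ρ b = finRotate m b → ρ (finRotate m b) = finRotate m (finRotate m b) := by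
      intro b hb
      rcases h (finRotate m b) with h2 | h2
      · exact absurd (ρ.injective (h2.trans hb.symm)) (finRotate_apply_ne hm b)
      · exact h2
    have hpow : ∀ i : ℕ, ρ (((finRotate m) ^ i) a₀) = finRotate m (((finRotate m) ^ i) a₀) := by
      intro i
      induction i with
      | zero => simpa using h0
      | succ i ih =>
        rw [pow_succ', Equiv.Perm.mul_apply]
        exact hstep _ ih
    right
    refine Equiv.ext fun b => ?_
    obtain ⟨i, hi⟩ := (isCycle_finRotate_of_le hm).exists_pow_eq (finRotate_apply_ne hm a₀)
      (finRotate_apply_ne hm b)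
    rw [← hi]
    exact hpow i

/-! ## 3. Unique reading of the witness exponent `W(c,c') = μ(c, id) + μ(c', rot)` -/

/-- The witness exponent of the pair `(c, c')`. [this file] -/
def quadWitness (m : ℕ) (c c' : Fin 3 → Fin (qOf m)) : (Fin (qOf m) × Fin (qOf m)) →₀ ℕ :=
  pmono m c 1 + pmono m c' (finRotate m)

/-- A cell of a summand is a cell of the sum (`ℕ`-valued exponents). [folklore] -/
theorem mem_support_add_left' {α : Type*} {f g : α →₀ ℕ} {s : α} (h : s ∈ f.support) :
    s ∈ (f + g).support := by
  rw [Finsupp.mem_support_iff] at h ⊢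
  rw [Finsupp.add_apply]
  omega

/-- A cell of the sum is a cell of a summand. [folklore] -/
theorem mem_support_add_cases {α : Type*} [DecidableEq α] {f g : α →₀ ℕ} {s : α} (h : s ∈ (f + g).support) :
    s ∈ f.support ∨ s ∈ g.support := by
  simpa [Finset.mem_union] using Finsupp.support_add h

/-- If every cell of `μ(d, ρ)` is a cell of `μ(c, σ)` or of `μ(c', τ)` then `ρ` agrees pointwise with `σ` or `τ`.
[this file] -/
theorem apply_eq_or_of_cells {c c' d : Fin 3 → Fin (qOf m)} {ρ σ τ : Equiv.Perm (Fin m)}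
    (h : ∀ s ∈ (pmono m d ρ).support, s ∈ (pmono m c σ).support ∨ s ∈ (pmono m c' τ).support) (a : Fin m) :
    ρ a = σ a ∨ ρ a = τ a := by
  rcases h _ (mem_support_pmono.2 ⟨a, rfl⟩) with h1 | h1
  · obtain ⟨b, hb⟩ := mem_support_pmono.1 h1
    obtain ⟨h2, rfl⟩ := Prod.mk.inj (pos_eq_of_cellEmb_eq hb)
    exact Or.inl h2
  · obtain ⟨b, hb⟩ := mem_support_pmono.1 h1
    obtain ⟨h2, rfl⟩ := Prod.mk.inj (pos_eq_of_cellEmb_eq hb)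
    exact Or.inr h2

/-- A cell of `μ(d, ρ)` is never a cell of `μ(c, σ)` when `ρ` and `σ` disagree everywhere. [this file] -/
theorem not_mem_support_pmono_of_ne {c d : Fin 3 → Fin (qOf m)} {ρ σ : Equiv.Perm (Fin m)}
    (hne : ∀ a, ρ a ≠ σ a) {s : Fin (qOf m) × Fin (qOf m)} (hs : s ∈ (pmono m d ρ).support) :
    s ∉ (pmono m c σ).support := by
  intro h
  obtain ⟨a, rfl⟩ := mem_support_pmono.1 hs
  obtain ⟨b, hb⟩ := mem_support_pmono.1 h
  obtain ⟨h2, rfl⟩ := Prod.mk.inj (pos_eq_of_cellEmb_eq hb)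
  exact hne _ h2

/-- **Unique reading.** If a monomial of `G_m(d)` times a monomial of `G_m(d')` has exponent `W(c,c')`, then the
patterns are `(id, rot)` with `(d, d') = (c, c')`, or `(rot, id)` with `(d, d') = (c', c)`. [this file] -/
theorem reading_unique (hm : 3 ≤ m) {c c' d d' : Fin 3 → Fin (qOf m)} {ρ ρ' : Equiv.Perm (Fin m)}
    (h : pmono m d ρ + pmono m d' ρ' = quadWitness m c c') :
    (ρ = 1 ∧ ρ' = finRotate m ∧ d = c ∧ d' = c') ∨ (ρ = finRotate m ∧ ρ' = 1 ∧ d = c' ∧ d' = c) := by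
  classical
  have hm2 : 2 ≤ m := by omega
  have hrot1 : ∀ a, finRotate m a ≠ (1 : Equiv.Perm (Fin m)) a := fun a => by
    rw [Equiv.Perm.one_apply]; exact finRotate_apply_ne hm2 a
  have h1rot : ∀ a, (1 : Equiv.Perm (Fin m)) a ≠ finRotate m a := fun a => (hrot1 a).symm
  -- cells of the left summands are cells of `W`
  have hL : ∀ s ∈ (pmono m d ρ).support, s ∈ (pmono m c 1).support ∨ s ∈ (pmono m c' (finRotate m)).support :=
    fun s hs => mem_support_add_cases (by rw [← quadWitness, ← h]; exact mem_support_add_left' hs)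
  have hR : ∀ s ∈ (pmono m d' ρ').support, s ∈ (pmono m c 1).support ∨ s ∈ (pmono m c' (finRotate m)).support :=
    fun s hs => mem_support_add_cases (by rw [← quadWitness, ← h, add_comm]; exact mem_support_add_left' hs)
  -- and conversely
  have hL' : ∀ s ∈ (pmono m c 1).support, s ∈ (pmono m d ρ).support ∨ s ∈ (pmono m d' ρ').support :=
    fun s hs => mem_support_add_cases (by rw [h, quadWitness]; exact mem_support_add_left' hs)
  have hR' : ∀ s ∈ (pmono m c' (finRotate m)).support, s ∈ (pmono m d ρ).support ∨ s ∈ (pmono m d' ρ').support :=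
    fun s hs => mem_support_add_cases (by rw [h, quadWitness, add_comm]; exact mem_support_add_left' hs)
  -- so `ρ, ρ' ∈ {id, rot}`
  have hρ : ρ = 1 ∨ ρ = finRotate m := perm_eq_one_or_finRotate hm2 ρ fun a => by
    simpa [Equiv.Perm.one_apply] using apply_eq_or_of_cells hL a
  have hρ' : ρ' = 1 ∨ ρ' = finRotate m := perm_eq_one_or_finRotate hm2 ρ' fun a => by
    simpa [Equiv.Perm.one_apply] using apply_eq_or_of_cells hR a
  have a₀ : Fin m := ⟨0, by omega⟩
  rcases hρ with rfl | rfl <;> rcases hρ' with rfl | rfl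
  · -- both `id`: the `rot`-cell of `W` at column `a₀` is nobody's cell
    exfalso
    have hs : cellEmb m c' (finRotate m a₀, a₀) ∈ (pmono m c' (finRotate m)).support :=
      mem_support_pmono.2 ⟨a₀, rfl⟩
    rcases hR' _ hs with h2 | h2
    · exact not_mem_support_pmono_of_ne hrot1 hs h2
    · exact not_mem_support_pmono_of_ne hrot1 hs h2
  · -- `(id, rot)`: block containments give `d = c`, `d' = c'`
    left
    refine ⟨rfl, rfl, ?_, ?_⟩
    · exact eq_of_support_pmono_subset hm fun s hs =>
        (hL s hs).resolve_right (not_mem_support_pmono_of_ne h1rot hs)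
    · exact eq_of_support_pmono_subset hm fun s hs =>
        (hR s hs).resolve_left (not_mem_support_pmono_of_ne hrot1 hs)
  · -- `(rot, id)`
    right
    refine ⟨rfl, rfl, ?_, ?_⟩
    · exact eq_of_support_pmono_subset hm fun s hs =>
        (hL s hs).resolve_left (not_mem_support_pmono_of_ne hrot1 hs)
    · exact eq_of_support_pmono_subset hm fun s hs =>
        (hR s hs).resolve_right (not_mem_support_pmono_of_ne h1rot hs)
  · -- both `rot`: the diagonal cell of `W` at column `a₀` is nobody's cell
    exfalso
    have hs : cellEmb m c ((1 : Equiv.Perm (Fin m)) a₀, a₀) ∈ (pmono m c 1).support :=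
      mem_support_pmono.2 ⟨a₀, rfl⟩
    rcases hL' _ hs with h2 | h2
    · exact not_mem_support_pmono_of_ne h1rot hs h2
    · exact not_mem_support_pmono_of_ne h1rot hs h2

end QuadraticRung

end Summit.ValiantsHypothesis.ValiantsHypothesis.Theorems.DefinabilityGapAffineRung

end
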